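import Summits.QuantumFields.YangMills.Theorems.UnitScaleTiltProp7CovLogTowerT3
import Summits.QuantumFields.YangMills.Theorems.UnitScaleTiltProp7DbarTwSymWindow
import Summits.QuantumFields.YangMills.Theorems.UnitScaleTiltProp7SymAvgGLSmallOfRegPr
import HarnessLib

/-!
# Route `UnitScaleTilt`, crux K1 «MinimiserStabilityRegPr» (stmt-QuantumFields-19200), route-R E′ (A′) P-A2 «JOINT-Σ», row F0″-c — **THE WINDOWS OF ✓`Prop7CovLogTower` DISCHARGED FROM
# `RegPr`**: for `U₀ ∈ 𝔘_k(ε₀)` under the L-only numerals `10⁹L²e ≤ 1`, `10¹²L³ε₀ ≤ 1`, (W1) EVERY level `m ≤ K − n` of the covariant tower of `e^{X}U₀♭` relative to the background tower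
# is within `3(2e + 2700Lε₀) ≤ ½` of `1` on the whole ball `‖X‖ < e·η` (✓W3 `norm_dbarCovIterU_rel_frameAccU_le_of_plaqSmall` AT EVERY LEVEL, budgets monotone in the level),
# (W0) `‖X b‖ ≤ 1/5` there, and (W2) every one-step map `Φ_{V_m}` of the log tower is differentiable at `0` (loop guards ✓`loopSmall_iter_of_regPr`); hence F0″-b's
# ★★★`l1_CmapTwS_le_damped_defects` with ONLY the column-sum letter `κ∕hT` (F2″) and the defect terms (F1″∕F3″) left displayed

Cell `ym3-torus` (HUMAN RULING D-0037: YM₃ on the torus is ladder rung R3 — not d = 4, not a mass gap, not Clay), width seat `ym3-torus-px18` (gen 3); ★p1 g17 WORD 10 (4)∕11 (e) «P-A2 F0″ →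
px18».  `--supports stmt-QuantumFields-19200 --as helper`; THEOREMS ONLY (0 `def`, 0 `sorry`); count-neutral.  Bookkeeping over landed bricks (W3 ★ym-ust-20520-w4 g3, W1 ★ym-ust-19200-w4 g3,
✓`Prop7SymAvgGLSmallOfRegPr` ★ym-ust-20520-w5); nothing of P-A2, hcoW, E′, EX, the crux, d = 4 or the mass gap is claimed.

WHAT IS PROVED (ns `…Theorems.Prop7CovLogTowerOfRegPr`; `U₀♭ = bgUnits F K U₀`, `V_m = emlIterU m U₀♭`, `η = eta F n K = L^{−(K−n)}`).
* §1 `level_budget_mono` (the two W3 budgets are monotone in the level size `Lᵐ ≤ L^{K−n}`), `succ_le_height` (`m ≤ K − n ⇒ m + 1 ≤ (F.P K).m + (F.P K).K`).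
* §2 ★★ `level_window_of_regPr` — (W1) AT EVERY LEVEL: `RegPr F n K ε₀ U₀`, `‖X b‖ ≤ e·η` ⇒ for all `m ≤ K − n` and level-`m` bonds `b`,
  `‖↑(dbarCovIterU m U₀♭ (e^{X}U₀♭) b)·↑((V_m b)⁻¹) − 1‖ ≤ 3(2e + 2700Lε₀)`; `window_lt_one_of_regPr` (`≤ ½ < 1`); `norm_apply_le_fifth` ((W0)).
* §3 ★ `differentiableAt_phiCov_zero_of_regPr` — (W2): every `Φ_{V_m}`, `m < K − n`, is differentiable at `0` (✓`Prop7CovLogTower.differentiableAt_phiCov_zero` ∘ loop guards of the averaged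
  backgrounds ✓`loopSmall_iter_of_regPr` ∘ ✓`coe_iter_eq_emlIterU_of_regPr` ∘ ✓`coe_loopHolU_unitsField`, `δ_{SU(2)} ≤ 1`).
* §4 ★★★ `hwinr_of_regPr` (F0″-b's `hwinr` at `r := e·η`) and ★★★ `l1_CmapTwS_le_damped_defects_of_regPr` — F0″-b's damped ℓ¹ bound with (W0)–(W2) DISCHARGED: displayed remain only
  the formal towers `Fm Lin` (✓`exists_iterate`∕`exists_lin`), F2″'s `κ, hT` (`m < K − n`), and the ball `‖X‖ < e·η`.
HONEST SCOPE.  The numerals are this lineage's crude L-only ones (`10⁹L²e ≤ 1`, `10¹²L³ε₀ ≤ 1`, as in ✓`Prop7DbarTwSymWindow`); no one-step defect, column-sum or mass estimate.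

References: T. Bałaban, CMP **98** (1985) 17–51 [Balaban1985Averaging] ((89)–(92) p.31, (97) p.32, (127) p.36, (150)–(152) pp.40–41, (161)–(163) p.42); CMP **102** (1985) 277–309
[Balaban1985Variational] ((2) p.278, (19) p.281, (44) p.285, (146) p.301); CMP **109** (1987) 249–301 [Balaban1987RG1] ((0.4) p.253).
-/

set_option autoImplicit false

noncomputable section

open scoped BigOperators Matrix.Norms.L2Operator

namespace Summit.QuantumFields.YangMills.Theorems.Prop7CovLogTowerOfRegPr

open NormedSpace
open Literature.MathematicalPhysics.QuantumFieldTheory.Balaban1983to89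
open Literature.MathematicalPhysics.QuantumFieldTheory.Balaban1983to89.T3ContinuumYM3Torus
open T4Continuum BlockAveraging AveragingRT ExpMeanLog
open MatrixLog (mlog)
open B7Prop1Explicit (expUnit val_expUnit)
open B10Eq27TorusAxialLog (unitsField toUField)
open T3RegularMinimiser (regThreshold)
open T3PrintedRegularMinimiser (RegPr)
open T3SectALandauChart (eta eta_pos bgUnits)
open T3LevelShift (bondShift)
open T3PrintedRegularOrbits (sites_eq)
open Summit.QuantumFields.YangMills.Theorems.Prop8Chart (loopHolU emlAvgU emlIterU expCfg coe_loopHolU_unitsField)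
open Summit.QuantumFields.YangMills.Theorems.Prop7SymAvgTwSym (dbarCovU dbarCovIterU CmapTwS)
open Summit.QuantumFields.YangMills.Theorems.Prop7SymAvgGLSmallOfRegPr (bgUnits_eq loopSmall_iter_of_regPr coe_iter_eq_emlIterU_of_regPr)
open Summit.QuantumFields.YangMills.Theorems.Prop7SymAvgRelativeBound (perturbedField_eq budget_T3)
open Summit.QuantumFields.YangMills.Theorems.Prop7DbarTwWindow (norm_smul_eta_inv_le)
open Summit.QuantumFields.YangMills.Theorems.Prop7SymFrameRelCluster (norm_dbarCovIterU_rel_frameAccU_le_of_plaqSmall)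
open Summit.QuantumFields.YangMills.Theorems.Prop7DbarTwSymWindow (budget_T3_frames windows_of_numerals hstep_T3 hframe_T3)
open Summit.QuantumFields.YangMills.Theorems.Prop7CovLogTower (differentiableAt_phiCov_zero l1_CmapTwS_le_damped_defects)

/-! ## §1 Arithmetic: the budgets are monotone in the level -/

/-- **THE TWO CLUSTER BUDGETS OF ✓W3 ARE MONOTONE IN THE LEVEL SIZE** `1 ≤ Y ≤ X` (`Y = Lᵐ`, `X = L^{K−n}`). [folklore] -/
theorem level_budget_mono {t ℓ d a₀ Y X : ℝ} (ht : 0 ≤ t) (hℓ : 0 ≤ ℓ) (hd : 0 ≤ d) (ha : 0 ≤ a₀) (hY : 1 ≤ Y) (hYX : Y ≤ X) :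
    Y * (2 * t + 30 * ℓ * (2 * (d * (3 * Y - 1)) * a₀)) ≤ X * (2 * t + 30 * ℓ * (2 * (d * (3 * X - 1)) * a₀)) ∧
      6400 * ℓ ^ 2 * Y * (2 * (d * (3 * Y - 1)) * a₀) ≤ 6400 * ℓ ^ 2 * X * (2 * (d * (3 * X - 1)) * a₀) := by
  have h2 : Y * (3 * Y - 1) ≤ X * (3 * X - 1) := by nlinarith
  have hc1 : 0 ≤ 60 * ℓ * d * a₀ := by positivity
  have hc2 : 0 ≤ 12800 * ℓ ^ 2 * d * a₀ := by positivity
  refine ⟨?_, ?_⟩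
  · have e1 : ∀ Z : ℝ, Z * (2 * t + 30 * ℓ * (2 * (d * (3 * Z - 1)) * a₀)) = 2 * t * Z + 60 * ℓ * d * a₀ * (Z * (3 * Z - 1)) := fun Z => by ring
    rw [e1, e1]
    have := mul_le_mul_of_nonneg_left h2 hc1
    nlinarith
  · have e1 : ∀ Z : ℝ, 6400 * ℓ ^ 2 * Z * (2 * (d * (3 * Z - 1)) * a₀) = 12800 * ℓ ^ 2 * d * a₀ * (Z * (3 * Z - 1)) := fun Z => by ring
    rw [e1, e1]
    exact mul_le_mul_of_nonneg_left h2 hc2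

/-- Levels below the top are inside the parameter range of the finest lattice: `m ≤ K − n ⇒ m + 1 ≤ (F.P K).m + (F.P K).K`. [cite: Balaban1985UV3, (1)-(3) p.256] -/
theorem succ_le_height (F : T3Family) (n K : ℕ) {m : ℕ} (hm : m ≤ K - n) : m + 1 ≤ (F.P K).m + (F.P K).K := by
  show m + 1 ≤ F.m + K
  have := F.hm
  omega

/-! ## §2 (W1) at every level and (W0), from `RegPr` -/

section Windows

variable (F : T3Family) {n K : ℕ} (h : n ≤ K)

/-- ★★ **(W1) AT EVERY LEVEL `m ≤ K − n`**: for `U₀ ∈ 𝔘_k(ε₀)` and `‖X b‖ ≤ e·η`, under `10⁹L²e ≤ 1`, `10¹²L³ε₀ ≤ 1`, the level-`m` covariant tower of `e^{X}U₀♭` relative to `Ū₀♭^{(m)}` satisfies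
`‖U̿^{(m)}(e^{X}U₀♭)(b)·Ū₀♭^{(m)}(b)⁻¹ − 1‖ ≤ 3(2e + 2700Lε₀)` — ✓W3 `norm_dbarCovIterU_rel_frameAccU_le_of_plaqSmall` at `k := m` with ✓`hstep_T3`∕`hframe_T3` (`C₁ = 22100`),
`RegPr.plaqSmall`, the rescaled exponent `A″ = (iη)⁻¹X` (✓`perturbedField_eq`), and the level-`m` budgets bounded by the top-level ones (§1, ✓`budget_T3_frames`, ✓`windows_of_numerals`).
[cite: Balaban1985Averaging, (89)–(92) p.31, (97) p.32, (161)–(163) p.42; Balaban1985Variational, (2) p.278, (19) p.281] -/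
theorem level_window_of_regPr {ε₀ e : ℝ} (hε₀ : 0 < ε₀) (he : 0 ≤ e) (hWe : 10 ^ 9 * (F.L : ℝ) ^ 2 * e ≤ 1) (hWε : 10 ^ 12 * (F.L : ℝ) ^ 3 * ε₀ ≤ 1)
    (U₀ : GaugeField (F.P K) 0 (Matrix.specialUnitaryGroup (Fin 2) ℂ)) (hreg : RegPr F n K ε₀ U₀)
    (X : PBond (F.P K) 0 → Matrix (Fin 2) (Fin 2) ℂ) (hX : ∀ b, ‖X b‖ ≤ e * eta F n K) {m : ℕ} (hm : m ≤ K - n) (b : PBond (F.P K) m) :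
    ‖((dbarCovIterU m (bgUnits F K U₀) (fun b' => expUnit (X b') * bgUnits F K U₀ b') b : (Matrix (Fin 2) (Fin 2) ℂ)ˣ) : Matrix (Fin 2) (Fin 2) ℂ) *
          (((emlIterU m (bgUnits F K U₀) b)⁻¹ : (Matrix (Fin 2) (Fin 2) ℂ)ˣ) : Matrix (Fin 2) (Fin 2) ℂ) - 1‖ ≤ 3 * (2 * e + 2700 * (F.L : ℝ) * ε₀) := by
  -- letters
  have hd : (F.P K).d = 3 := T3Family.P_d F K
  have hLL : ((F.P K).L : ℝ) = F.L := rfl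
  have hL3 : 3 ≤ F.L := by obtain ⟨a, ha⟩ := F.hL.1; have := F.hL.2; omega
  have hL0 : (0 : ℝ) < F.L := by exact_mod_cast (show 0 < F.L by omega)
  have hL1 : (1 : ℝ) ≤ F.L := by exact_mod_cast (show 1 ≤ F.L by omega)
  have hk : m + 1 ≤ (F.P K).m + (F.P K).K := succ_le_height F n K hm
  have hℓ : ((((F.P K).d + 2) * (F.P K).L : ℕ) : ℝ) = 5 * (F.L : ℝ) := by
    rw [hd, ← hLL]; push_cast; ring
  obtain ⟨hWF, hε, he6⟩ := windows_of_numerals F hε₀.le he hWe hWε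
  obtain ⟨hsB0, hxX, hbud₀⟩ := budget_T3_frames F (n := n) (K := K) e hε₀ hε
  set η : ℝ := ((F.L : ℝ)⁻¹) ^ (K - n) with hη
  have hη0 : 0 < η := by positivity
  have hηne : η ≠ 0 := hη0.ne'
  have hηeta : eta F n K = η := rfl
  set a₀ : ℝ := regThreshold F n K ε₀ with ha₀
  have ha₀0 : 0 < a₀ := by rw [ha₀]; unfold regThreshold; positivity
  have hXa : (F.L : ℝ) ^ (K - n) * ((F.L : ℝ) ^ (K - n) * a₀) = ε₀ := by
    have hX2 : (F.L : ℝ) ^ (K - n) * (F.L : ℝ) ^ (K - n) = (F.L : ℝ) ^ (2 * (K - n)) := by rw [← pow_add, two_mul]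
    have ha : a₀ = ε₀ * ((F.L : ℝ) ^ (2 * (K - n)))⁻¹ := by rw [ha₀]; unfold regThreshold; rw [inv_pow]
    rw [← mul_assoc, hX2, ha, mul_comm ε₀, ← mul_assoc, mul_inv_cancel₀ (pow_ne_zero _ hL0.ne'), one_mul]
  have hU := hreg.1
  obtain ⟨ht1, -, -, -⟩ := budget_T3 F (K - n) hε₀ hε he he6 ha₀0.le hXa
  -- monotonicity of the level-`m` budgets (`Lᵐ ≤ L^{K−n}`)
  have hYX : ((F.P K).L : ℝ) ^ m ≤ ((F.P K).L : ℝ) ^ (K - n) := by rw [hLL]; exact pow_le_pow_right₀ hL1 hm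
  have hY1 : (1 : ℝ) ≤ ((F.P K).L : ℝ) ^ m := by rw [hLL]; exact one_le_pow₀ hL1
  have hℓ0 : 0 ≤ ((((F.P K).d + 2) * (F.P K).L : ℕ) : ℝ) := Nat.cast_nonneg _
  have hd0 : 0 ≤ ((F.P K).d : ℝ) := Nat.cast_nonneg _
  obtain ⟨hmono, hmono₀⟩ := level_budget_mono (t := η * e) (mul_nonneg hη0.le he) hℓ0 hd0 ha₀0.le hY1 hYX
  have hxXm : ((F.P K).L : ℝ) ^ m * (2 * (η * e) +
      30 * ((((F.P K).d + 2) * (F.P K).L : ℕ) : ℝ) * (2 * (((F.P K).d : ℝ) * (3 * ((F.P K).L : ℝ) ^ m - 1)) * a₀)) ≤ 2 * e + 2700 * (F.L : ℝ) * ε₀ :=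
    hmono.trans hxX
  have hbud₀m : 6400 * ((((F.P K).d + 2) * (F.P K).L : ℕ) : ℝ) ^ 2 * ((F.P K).L : ℝ) ^ m * (2 * (((F.P K).d : ℝ) * (3 * ((F.P K).L : ℝ) ^ m - 1)) * a₀) ≤ 1 :=
    hmono₀.trans hbud₀
  have hbudm : 8 * (16 * (22100 : ℝ) + 2) * ((((F.P K).d + 2) * (F.P K).L : ℕ) : ℝ) ^ 2 *
      (((F.P K).L : ℝ) ^ m * (2 * (η * e) + 30 * ((((F.P K).d + 2) * (F.P K).L : ℕ) : ℝ) * (2 * (((F.P K).d : ℝ) * (3 * ((F.P K).L : ℝ) ^ m - 1)) * a₀))) ≤ 1 := by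
    have hC : 0 ≤ 8 * (16 * (22100 : ℝ) + 2) * ((((F.P K).d + 2) * (F.P K).L : ℕ) : ℝ) ^ 2 := by positivity
    refine (mul_le_mul_of_nonneg_left hxXm hC).trans ?_
    rw [hℓ]; exact hWF
  -- the rescaled exponent `A″ = (iη)⁻¹X`: `‖ηA″(b)‖ ≤ ηe`
  have hA' : ∀ b', ‖(η : ℂ) • ((fun b' => (Complex.I * (η : ℂ))⁻¹ • X b') b')‖ ≤ η * e := fun b' =>
    norm_smul_eta_inv_le F hηne X (fun b' => by rw [← hηeta]; exact hX b') b'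
  -- ✓W3 at level `m`
  obtain ⟨hrel, -, -⟩ := norm_dbarCovIterU_rel_frameAccU_le_of_plaqSmall (P := F.P K) (by norm_num : (2 : ℝ) ≤ 22100) (hstep_T3 F) (hframe_T3 F) hk U₀ ha₀0 hU η
    (fun b' => (Complex.I * (η : ℂ))⁻¹ • X b') ht1 hA' hbud₀m hbudm b
  -- the dictionary: the perturbed field and the background in W3's letters
  have hW : (fun b' => expUnit (X b') * bgUnits F K U₀ b') = fun b' => expCfg η (fun b' => (Complex.I * (η : ℂ))⁻¹ • X b') b' * unitsField (toUField U₀) b' :=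
    perturbedField_eq F K hηne U₀ X
  rw [hW, bgUnits_eq]
  exact hrel.trans (by linarith)

/-- **`3(2e + 2700Lε₀) ≤ ½`** under the numerals (`L ≥ 3`). [cite: Balaban1985Variational, (2) p.278] -/
theorem three_window_le_half {ε₀ e : ℝ} (hε₀ : 0 < ε₀) (hWe : 10 ^ 9 * (F.L : ℝ) ^ 2 * e ≤ 1) (hWε : 10 ^ 12 * (F.L : ℝ) ^ 3 * ε₀ ≤ 1) :
    3 * (2 * e + 2700 * (F.L : ℝ) * ε₀) ≤ 1 / 2 := by
  have hL3 : 3 ≤ F.L := by obtain ⟨a, ha⟩ := F.hL.1; have := F.hL.2; omega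
  have hL3r : (3 : ℝ) ≤ F.L := by exact_mod_cast hL3
  have h9 : (9 : ℝ) ≤ (F.L : ℝ) ^ 2 := by nlinarith
  have hL13 : (F.L : ℝ) ≤ (F.L : ℝ) ^ 3 := by nlinarith
  have ha : (F.L : ℝ) * ε₀ ≤ (F.L : ℝ) ^ 3 * ε₀ := mul_le_mul_of_nonneg_right hL13 hε₀.le
  nlinarith

/-- ★ **(W1) AS A STRICT WINDOW**: `< 1` (indeed `≤ ½`) at every level `m ≤ K − n` and every level-`m` bond. [cite: Balaban1985Averaging, (161)–(163) p.42; Balaban1985RegularSpaces, (1.31) p.82] -/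
theorem window_lt_one_of_regPr {ε₀ e : ℝ} (hε₀ : 0 < ε₀) (he : 0 ≤ e) (hWe : 10 ^ 9 * (F.L : ℝ) ^ 2 * e ≤ 1) (hWε : 10 ^ 12 * (F.L : ℝ) ^ 3 * ε₀ ≤ 1)
    (U₀ : GaugeField (F.P K) 0 (Matrix.specialUnitaryGroup (Fin 2) ℂ)) (hreg : RegPr F n K ε₀ U₀)
    (X : PBond (F.P K) 0 → Matrix (Fin 2) (Fin 2) ℂ) (hX : ∀ b, ‖X b‖ ≤ e * eta F n K) {m : ℕ} (hm : m ≤ K - n) (b : PBond (F.P K) m) :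
    ‖((dbarCovIterU m (bgUnits F K U₀) (fun b' => expUnit (X b') * bgUnits F K U₀ b') b : (Matrix (Fin 2) (Fin 2) ℂ)ˣ) : Matrix (Fin 2) (Fin 2) ℂ) *
          (((emlIterU m (bgUnits F K U₀) b)⁻¹ : (Matrix (Fin 2) (Fin 2) ℂ)ˣ) : Matrix (Fin 2) (Fin 2) ℂ) - 1‖ < 1 :=
  ((level_window_of_regPr F hε₀ he hWe hWε U₀ hreg X hX hm b).trans (three_window_le_half F hε₀ hWe hWε)).trans_lt (by norm_num)

/-- **(W0)**: on the ball `‖X‖ < e·η` every bond variable has `‖X b‖ ≤ 1/5` (`e·η ≤ 10⁻⁹`). [cite: Balaban1985Variational, (2) p.278, (19) p.281] -/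
theorem norm_apply_le_fifth {e : ℝ} (he : 0 ≤ e) (hWe : 10 ^ 9 * (F.L : ℝ) ^ 2 * e ≤ 1)
    {X : PBond (F.P K) 0 → Matrix (Fin 2) (Fin 2) ℂ} (hX : ‖X‖ < e * eta F n K) (b : PBond (F.P K) 0) : ‖X b‖ ≤ 1 / 5 := by
  have hL3 : 3 ≤ F.L := by obtain ⟨a, ha⟩ := F.hL.1; have := F.hL.2; omega
  have hL1r : (1 : ℝ) ≤ F.L := by exact_mod_cast (show 1 ≤ F.L by omega)
  have hη1 : eta F n K ≤ 1 := by
    unfold eta; exact pow_le_one₀ (inv_nonneg.2 (by positivity)) (inv_le_one_of_one_le₀ hL1r)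
  have he1 : e ≤ 1 / 5 := by nlinarith [one_le_pow₀ (M₀ := ℝ) hL1r (n := 2)]
  have h1 : ‖X b‖ ≤ ‖X‖ := norm_le_pi_norm X b
  have h2 : e * eta F n K ≤ e * 1 := mul_le_mul_of_nonneg_left hη1 he
  linarith

end Windows

/-! ## §3 (W2): the one-step maps of the log tower are differentiable at `0` on `𝔘_k(ε₀)` -/

section Diff

variable (F : T3Family) {n K : ℕ} (h : n ≤ K)

/-- ★ **(W2) FROM `RegPr`**: for every `m < K − n` the one-step map `Φ_{V_m}` (`V_m = Ū₀♭^{(m)}`) is differentiable at `0` — the (0.4) loop guards of every averaging step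
(✓`loopSmall_iter_of_regPr`, `δ_{SU(2)} ≤ 1`) read on the complexified tower (✓`coe_iter_eq_emlIterU_of_regPr`, ✓`coe_loopHolU_unitsField`) feed ✓`differentiableAt_phiCov_zero`.
[cite: Balaban1985Variational, (146) p.301; Balaban1987RG1, (0.4) p.253; Balaban1985Averaging, (127) p.36] -/
theorem differentiableAt_phiCov_zero_of_regPr {ε₀ : ℝ} (hε₀ : 0 < ε₀) (hε : 10 ^ 7 * (F.L : ℝ) ^ 3 * ε₀ ≤ 1)
    (U₀ : GaugeField (F.P K) 0 (Matrix.specialUnitaryGroup (Fin 2) ℂ)) (hreg : RegPr F n K ε₀ U₀) {m : ℕ} (hm : m < K - n) :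
    DifferentiableAt ℂ (fun y : PBond (F.P K) m → Matrix (Fin 2) (Fin 2) ℂ => fun c : PBond (F.P K) (m + 1) =>
        mlog (((dbarCovU (emlIterU m (bgUnits F K U₀)) (fun b => expUnit (y b) * emlIterU m (bgUnits F K U₀) b) c : (Matrix (Fin 2) (Fin 2) ℂ)ˣ) : Matrix (Fin 2) (Fin 2) ℂ) *
          (((emlAvgU (emlIterU m (bgUnits F K U₀)) c)⁻¹ : (Matrix (Fin 2) (Fin 2) ℂ)ˣ) : Matrix (Fin 2) (Fin 2) ℂ))) 0 := by
  have hk : m + 1 ≤ (F.P K).m + (F.P K).K := succ_le_height F n K hm.le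
  refine differentiableAt_phiCov_zero hk (emlIterU m (bgUnits F K U₀)) fun c i => ?_
  have hV : emlIterU m (bgUnits F K U₀) = unitsField (toUField (Averaging.iter (fun l => blockAvg (P := F.P K) (j := l) T3UnitLawDensityEML.ℰp) m U₀)) := by
    rw [bgUnits_eq]; exact (coe_iter_eq_emlIterU_of_regPr F n K hε₀ hε hreg hm.le).symm
  rw [hV, coe_loopHolU_unitsField]
  have hδ : deltaSU (Fin 2) ≤ 1 := by rw [deltaSU]; exact (min_le_left _ _).trans (by norm_num)
  exact (loopSmall_iter_of_regPr F n K hε₀ hε hreg m hm.le c i).trans_le hδ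

end Diff

/-! ## §4 ★★★ F0″ with the windows discharged -/

section Assembly

variable (F : T3Family) (n K : ℕ) (h : n ≤ K)

/-- ★★★ **F0″-b's `hwinr` AT `r := e·η`, FROM `RegPr`.** [cite: Balaban1985Averaging, (161)–(163) p.42; Balaban1985Variational, (2) p.278, (19) p.281] -/
theorem hwinr_of_regPr {ε₀ e : ℝ} (hε₀ : 0 < ε₀) (he : 0 ≤ e) (hWe : 10 ^ 9 * (F.L : ℝ) ^ 2 * e ≤ 1) (hWε : 10 ^ 12 * (F.L : ℝ) ^ 3 * ε₀ ≤ 1)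
    (U₀ : GaugeField (F.P K) 0 (Matrix.specialUnitaryGroup (Fin 2) ℂ)) (hreg : RegPr F n K ε₀ U₀) :
    ∀ X : PBond (F.P K) 0 → Matrix (Fin 2) (Fin 2) ℂ, ‖X‖ < e * eta F n K → (∀ b, ‖X b‖ ≤ 1 / 5) ∧ ∀ m, m < K - n → ∀ b : PBond (F.P K) m,
      ‖((dbarCovIterU m (bgUnits F K U₀) (fun b' => expUnit (X b') * bgUnits F K U₀ b') b : (Matrix (Fin 2) (Fin 2) ℂ)ˣ) : Matrix (Fin 2) (Fin 2) ℂ) *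
          (((emlIterU m (bgUnits F K U₀) b)⁻¹ : (Matrix (Fin 2) (Fin 2) ℂ)ˣ) : Matrix (Fin 2) (Fin 2) ℂ) - 1‖ < 1 :=
  fun X hXr => ⟨fun b => norm_apply_le_fifth F (n := n) (K := K) he hWe hXr b,
    fun _ hm b => window_lt_one_of_regPr F hε₀ he hWe hWε U₀ hreg X (fun b' => (norm_le_pi_norm X b').trans hXr.le) hm.le b⟩

/-- ★★★ **P-A2 F0″ WITH THE WINDOWS DISCHARGED — the ℓ¹ size of the twisted chart remainder `C^{twS}(X)` is the damped sum of the one-step defects along the log tower**, for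
`U₀ ∈ 𝔘_k(ε₀)`, `10⁹L²e ≤ 1`, `10¹²L³ε₀ ≤ 1`, every `X` with `‖X‖ < e·η`; displayed: the formal towers `Fm`, `Lin` (take them from ✓`Prop7CovLogTower.exists_iterate`∕`exists_lin`) and
F2″'s column-sum letter `κ` of the one-step linear parts for `m < K − n`. [cite: Balaban1985Averaging, (150)–(152) pp.40–41; Balaban1985Variational, (44) p.285] -/
theorem l1_CmapTwS_le_damped_defects_of_regPr {ε₀ e : ℝ} (hε₀ : 0 < ε₀) (he : 0 < e) (hWe : 10 ^ 9 * (F.L : ℝ) ^ 2 * e ≤ 1) (hWε : 10 ^ 12 * (F.L : ℝ) ^ 3 * ε₀ ≤ 1)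
    (U₀ : GaugeField (F.P K) 0 (Matrix.specialUnitaryGroup (Fin 2) ℂ)) (hreg : RegPr F n K ε₀ U₀)
    (Fm : (m : ℕ) → (PBond (F.P K) 0 → Matrix (Fin 2) (Fin 2) ℂ) → (PBond (F.P K) m → Matrix (Fin 2) (Fin 2) ℂ)) (hF0 : ∀ x, Fm 0 x = x)
    (hFs : ∀ (m : ℕ) (x : PBond (F.P K) 0 → Matrix (Fin 2) (Fin 2) ℂ), Fm (m + 1) x =
        (fun y : PBond (F.P K) m → Matrix (Fin 2) (Fin 2) ℂ => fun c : PBond (F.P K) (m + 1) =>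
          mlog (((dbarCovU (emlIterU m (bgUnits F K U₀)) (fun b => expUnit (y b) * emlIterU m (bgUnits F K U₀) b) c : (Matrix (Fin 2) (Fin 2) ℂ)ˣ) : Matrix (Fin 2) (Fin 2) ℂ) *
            (((emlAvgU (emlIterU m (bgUnits F K U₀)) c)⁻¹ : (Matrix (Fin 2) (Fin 2) ℂ)ˣ) : Matrix (Fin 2) (Fin 2) ℂ))) (Fm m x))
    (Lin : (m : ℕ) → (PBond (F.P K) 0 → Matrix (Fin 2) (Fin 2) ℂ) →L[ℂ] (PBond (F.P K) m → Matrix (Fin 2) (Fin 2) ℂ))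
    (hLin0 : Lin 0 = ContinuousLinearMap.id ℂ (PBond (F.P K) 0 → Matrix (Fin 2) (Fin 2) ℂ))
    (hLins : ∀ m : ℕ, Lin (m + 1) =
        (fderiv ℂ (fun y : PBond (F.P K) m → Matrix (Fin 2) (Fin 2) ℂ => fun c : PBond (F.P K) (m + 1) =>
          mlog (((dbarCovU (emlIterU m (bgUnits F K U₀)) (fun b => expUnit (y b) * emlIterU m (bgUnits F K U₀) b) c : (Matrix (Fin 2) (Fin 2) ℂ)ˣ) : Matrix (Fin 2) (Fin 2) ℂ) *
            (((emlAvgU (emlIterU m (bgUnits F K U₀)) c)⁻¹ : (Matrix (Fin 2) (Fin 2) ℂ)ˣ) : Matrix (Fin 2) (Fin 2) ℂ))) 0).comp (Lin m))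
    {κ : ℝ} (hκ : 0 ≤ κ)
    (hT : ∀ m : ℕ, m < K - n → ∀ v : PBond (F.P K) m → Matrix (Fin 2) (Fin 2) ℂ, ∑ c, ‖fderiv ℂ (fun y : PBond (F.P K) m → Matrix (Fin 2) (Fin 2) ℂ => fun c : PBond (F.P K) (m + 1) =>
          mlog (((dbarCovU (emlIterU m (bgUnits F K U₀)) (fun b => expUnit (y b) * emlIterU m (bgUnits F K U₀) b) c : (Matrix (Fin 2) (Fin 2) ℂ)ˣ) : Matrix (Fin 2) (Fin 2) ℂ) *
            (((emlAvgU (emlIterU m (bgUnits F K U₀)) c)⁻¹ : (Matrix (Fin 2) (Fin 2) ℂ)ˣ) : Matrix (Fin 2) (Fin 2) ℂ))) 0 v c‖ ≤ κ * ∑ c', ‖v c'‖)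
    (X : PBond (F.P K) 0 → Matrix (Fin 2) (Fin 2) ℂ) (hXr : ‖X‖ < e * eta F n K) :
    ∑ c : PBond (F.P n) 0, ‖CmapTwS F n K h U₀ X c‖ ≤
      ∑ l ∈ Finset.range (K - n), κ ^ (K - n - 1 - l) * ∑ c', ‖((fun y : PBond (F.P K) l → Matrix (Fin 2) (Fin 2) ℂ => fun c : PBond (F.P K) (l + 1) =>
          mlog (((dbarCovU (emlIterU l (bgUnits F K U₀)) (fun b => expUnit (y b) * emlIterU l (bgUnits F K U₀) b) c : (Matrix (Fin 2) (Fin 2) ℂ)ˣ) : Matrix (Fin 2) (Fin 2) ℂ) *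
            (((emlAvgU (emlIterU l (bgUnits F K U₀)) c)⁻¹ : (Matrix (Fin 2) (Fin 2) ℂ)ˣ) : Matrix (Fin 2) (Fin 2) ℂ))) (Fm l X) -
        fderiv ℂ (fun y : PBond (F.P K) l → Matrix (Fin 2) (Fin 2) ℂ => fun c : PBond (F.P K) (l + 1) =>
          mlog (((dbarCovU (emlIterU l (bgUnits F K U₀)) (fun b => expUnit (y b) * emlIterU l (bgUnits F K U₀) b) c : (Matrix (Fin 2) (Fin 2) ℂ)ˣ) : Matrix (Fin 2) (Fin 2) ℂ) *
            (((emlAvgU (emlIterU l (bgUnits F K U₀)) c)⁻¹ : (Matrix (Fin 2) (Fin 2) ℂ)ˣ) : Matrix (Fin 2) (Fin 2) ℂ))) 0 (Fm l X)) c'‖ := by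
  have hε7 : 10 ^ 7 * (F.L : ℝ) ^ 3 * ε₀ ≤ 1 := (windows_of_numerals F hε₀.le he.le hWe hWε).2.1
  exact l1_CmapTwS_le_damped_defects F n K h U₀ Fm hF0 hFs Lin hLin0 hLins (mul_pos he (eta_pos F n K))
    (hwinr_of_regPr F n K hε₀ he.le hWe hWε U₀ hreg) (fun m hm => differentiableAt_phiCov_zero_of_regPr F hε₀ hε7 U₀ hreg hm) hκ hT X hXr

end Assembly

end Summit.QuantumFields.YangMills.Theorems.Prop7CovLogTowerOfRegPr

end
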